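import Summits.CriticalPhenomena.Ising3D.IsingColumnFaceL11
import Summits.CriticalPhenomena.Ising3D.ExclusionSentencesControl2DZeta

/-!
# The σ-cell's `LIN` (and `Γ`-free `TRG`) catalogue members as kernel facts (cell `pub-ising3x`,
seat recog-1; paper §7.3, companion of `IsingColumnFaceL11Census{,Kacx,SigmaCell}.lean`)

HONEST FRAMING: lottery ticket; floor = tightest certified 3D Ising CFT bounds; no exact-solution
claim without a proof. Island framing: certified exclusion region at stated derivative order and
assumptions; not a determination of the 3D Ising critical exponents beyond that.
HONEST SCOPE: a statement about the frozen catalogue's members inside `σcell = [33957/65536, 16979/32768]`,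
NOT about `Δσ`; Theorem 1's region has no σ-face, no bridge is instantiated (the σ-cell is the campaign's input
cell).

Paper §7.3, last sentence: «For the σ-cell itself the catalogue holds 4 rationals with denominator
≤ 1000 (…), 12 algebraic, 13 linear-form and 12 trigonometric members (…) and no Kac, extended-Kac or
named value — again a statement about the catalogue's density, not about Δσ.» The rational / Kac /
extended-Kac / named clauses are kernel facts (p627113, p639014); the counts «13 linear-form», «12
trigonometric», «12 algebraic» were census numbers of the frozen recogniser (`list_members.py` v1.0.5 on
FAMILIES-v1 `b39f709f…`, record `HOME/pub-ising3x-recog-1/gen42/s7/sig.jsonl`). This module makes the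
`LIN` clause a KERNEL FACT, with the lane's phase-1 driver of record (`tools/kernel_report.py`, the twins
`trglin_exceptions.py` / `trg_gamma_exceptions.py` / `alg_exceptions.py` — the same tools behind the landed
2D-control instances `ExclusionSentencesControl2D{Zeta,TrgGamma*,Alg}.lean` and `control2D_sigma_catalogue`):
* `σcellLinEx` — the thirteen `LIN` tuples `(a₀, [c_π, c_π², c_π³, c_log2, c_ζ(3), c_ζ(5), c_G], aₓ)` of the
  frozen table (`H = 12`: `|cᵢ|, aₓ ≤ 12`, at most two `cᵢ ≠ 0`, seven constants) whose value
  `(a₀ + Σ cᵢKᵢ)/aₓ` lies in `σcell = [33957/65536, 16979/32768]`;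
* COMPLETENESS `lin_listed_of_mem_σcell`: every member of `linFamily 12` in the σ-cell is the value of a
  listed tuple — by the cell's checker `linExcluded 12 … = true` (four `linExcludedPart` decisions,
  `decide +kernel`, ≈ 30 s each);
* MEMBERSHIP `σcellLinEx_mem_σcell` (each listed value lies in the σ-cell, by its certified enclosure
  `linTupleEncl` over the tree's constants `piI`, `log2I`, `zeta3I`, `zeta5I`, `catalanI`) and
  `σcellLinEx_mem_linFamily` (each listed tuple satisfies the family's side conditions), so the list is
  EXACT; `σcellLinEx_separated` (the thirteen enclosures are pairwise disjoint ⇒ thirteen distinct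
  values, `σcellLinEx_nodup_values`) ⇒ **`σcell_lin_ncard`: exactly 13 distinct `LIN` values in the σ-cell**;
* the `Γ`-free `TRG` sub-table (`trgFamily 12 32`): its only member in the σ-cell is `(2/5)·√2·G`
  (`trg_listed_of_mem_σcell`, `σcellTrgEx`; the value placed in the cell by p640404's
  `trg_example_mem_σcell`); the whole `TRG` table (with `Γ(¼)`, `Γ(⅓)` powers; twelve members) is the
  companion pair `IsingColumnFaceL11CensusSigmaCellTrg{,Fin}.lean`.

KERNEL-COST DEVICE (measured this session, recorded for later seats): the checkers are run on the DECIMAL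
superset window `σW = [σWlo, σWhi] = [0.5181427, 0.51815796] ⊇ σcell` (margins `2·10⁻¹⁰`, `1·10⁻⁹`; the
member lists of `σW` and `σcell` coincide, all thirteen/one/twelve values lying inside `σcell`) and the
sentences are restricted to `σcell` by `mem_σW_of_mem_σcell`. Reason: on the cell's own DYADIC end points
`33957/2¹⁶, 16979/2¹⁵` the scaled-integer `ALG` checker is 17–25× slower in the kernel for the identical
search (313 s vs 13 s for the degree-2 sentence; same candidate / sign-test / deflation counts in the Python
twin), a bignum effect of end points whose products are multiples of `2³¹`; decimal end points avoid it.

What this module is NOT: a statement about `Δσ` of the 3D Ising CFT. Theorem 1 (`isingColumnFace_L11`) has no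
σ-face — its region is `{Δε > 2855/2048}` — so no bridge lemma is instantiated here; the σ-cell is the
campaign's INPUT cell and these are facts about the frozen catalogue's density in it (§7.3: «not about Δσ»).
No certificate, no datum, no axiom of the σ–ε system is used. [folklore]
lottery ticket; floor = tightest certified 3D Ising CFT bounds; no exact-solution claim without a proof.
-/

namespace Summit.CriticalPhenomena.Ising3D
namespace ColumnFaceL11
open Set Literature.MathematicalPhysics.QuantumFieldTheory.ConformalBootstrap3D

/-! ### The decimal superset window `σW ⊇ σcell` (kernel-cost device) -/

/-- Lower end point of the decimal window `σW = [0.5181427, 0.51815796] ⊇ σcell`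
(`33957/65536 = 0.51814270019…`). [folklore] -/
def σWlo : ℚ := 5181427 / 10000000

/-- Upper end point of the decimal window `σW ⊇ σcell` (`16979/32768 = 0.51815795898…`). [folklore] -/
def σWhi : ℚ := 51815796 / 100000000

/-- `σcell ⊆ σW`: a point of the σ-cell satisfies the interval hypothesis of every checker sentence of this
module and its companions. [folklore] -/
theorem mem_σW_of_mem_σcell {x : ℝ} (hx : x ∈ σcell) : ((σWlo : ℚ) : ℝ) ≤ x ∧ x ≤ ((σWhi : ℚ) : ℝ) := by
  simp only [σcell, mem_Icc] at hx
  simp only [σWlo, σWhi]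
  push_cast
  constructor <;> linarith [hx.1, hx.2]

/-! ### Family `LIN` (`H = 12`, seven constants) on the σ-cell -/

/-- The thirteen `LIN` tuples `(a₀, [c_π, c_π², c_π³, c_log2, c_ζ(3), c_ζ(5), c_G], aₓ)` whose value
`(a₀ + Σ cᵢKᵢ)/aₓ` lies in the σ-cell (frozen table `H = 12`; record `gen42/s7/sig.jsonl`; regenerated by
`tools/kernel_report.py` on `σW`, identical list). In the record's notation: `(16 − 9ζ(3))/10`,
`(−94 − π + 10π²)/3`, `(257 + 9π − 9π³)/12`, `(15 − 4π + 3G)/10`, `(246 + 10π² − 11π³)/7`,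
`(−230 + 11π² + 4π³)/5`, `(126 − 12π² − 5ζ(3))/3`, `(−110 + 12π² − 4ζ(3))/7`, `(106 − 3π³ − 12 log 2)/9`,
`(−273 + 9π³ − 5 log 2)/5`, `(20 − 9 log 2 − 8ζ(3))/8`, `(12 + 9 log 2 − 10ζ(3))/12`,
`(10 + 11 log 2 − 12ζ(5))/10` (heights 16, 94, 257, 15, 246, 230, 126, 110, 106, 273, 20, 12, 12). [folklore] -/
def σcellLinEx : List (ℤ × List ℤ × ℕ) :=
  [(16, [0, 0, 0, 0, -9, 0, 0], 10), (-94, [-1, 10, 0, 0, 0, 0, 0], 3), (257, [9, 0, -9, 0, 0, 0, 0], 12),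
   (15, [-4, 0, 0, 0, 0, 0, 3], 10), (246, [0, 10, -11, 0, 0, 0, 0], 7), (-230, [0, 11, 4, 0, 0, 0, 0], 5),
   (126, [0, -12, 0, 0, -5, 0, 0], 3), (-110, [0, 12, 0, 0, -4, 0, 0], 7), (106, [0, 0, -3, -12, 0, 0, 0], 9),
   (-273, [0, 0, 9, -5, 0, 0, 0], 5), (20, [0, 0, 0, -9, -8, 0, 0], 8), (12, [0, 0, 0, 9, -10, 0, 0], 12),
   (10, [0, 0, 0, 11, 0, -12, 0], 10)]

/-- Part 0 of the `H = 12` `LIN` sentence on `σW` (one `decide +kernel`, ≈ 30 s). [folklore] -/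
theorem linExcludedPart_σW_p0 : linExcludedPart 12 0 σWlo σWhi σcellLinEx = true := by
  decide +kernel

/-- Part 1 of the `H = 12` `LIN` sentence on `σW`. [folklore] -/
theorem linExcludedPart_σW_p1 : linExcludedPart 12 1 σWlo σWhi σcellLinEx = true := by
  decide +kernel

/-- Part 2 of the `H = 12` `LIN` sentence on `σW`. [folklore] -/
theorem linExcludedPart_σW_p2 : linExcludedPart 12 2 σWlo σWhi σcellLinEx = true := by
  decide +kernel

/-- Part 3 of the `H = 12` `LIN` sentence on `σW`. [folklore] -/
theorem linExcludedPart_σW_p3 : linExcludedPart 12 3 σWlo σWhi σcellLinEx = true := by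
  decide +kernel

/-- The `LIN` sentence (`H = 12`, all seven constants) on `σW`: the listed tuples are the COMPLETE member
list. [folklore] -/
theorem linExcluded_σW : linExcluded 12 σWlo σWhi σcellLinEx = true :=
  linExcluded_of_parts linExcludedPart_σW_p0 linExcludedPart_σW_p1 linExcludedPart_σW_p2
    linExcludedPart_σW_p3

/-- **Completeness on the σ-cell.** Every member of the frozen `LIN` table (`linFamily 12`: forms
`(a₀ + Σ cᵢKᵢ)/aₓ` in `π, π², π³, log 2, ζ(3), ζ(5), G` with `|cᵢ|, aₓ ≤ 12`, at most two `cᵢ ≠ 0`) that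
lies in the σ-cell is the value of one of the thirteen listed tuples. [folklore] -/
theorem lin_listed_of_mem_σcell {x : ℝ} (hx : x ∈ σcell) (hm : x ∈ linFamily 12) :
    ∃ e ∈ σcellLinEx, x = lin7TupleVal e :=
  linExcluded_sound linExcluded_σW (mem_σW_of_mem_σcell hx) hm

/-! ### The listed `LIN` values lie in the σ-cell, belong to the family, and are pairwise distinct -/

/-- Every tuple of `ex` has `aₓ > 0` and a certified value enclosure INSIDE `[a, b]`. [folklore] -/
def linTuplesInside (a b : ℚ) (ex : List (ℤ × List ℤ × ℕ)) : Bool :=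
  ex.all fun e => decide (0 < e.2.2) && decide (a ≤ (linTupleEncl e).1) && decide ((linTupleEncl e).2 ≤ b)

/-- Soundness of `linTuplesInside`: each listed value lies in `[a, b]`. [folklore] -/
theorem linTuplesInside_sound {a b : ℚ} {ex : List (ℤ × List ℤ × ℕ)} (h : linTuplesInside a b ex = true)
    {e : ℤ × List ℤ × ℕ} (he : e ∈ ex) : (a : ℝ) ≤ lin7TupleVal e ∧ lin7TupleVal e ≤ b := by
  unfold linTuplesInside at h
  have h1 := List.all_eq_true.mp h e he
  simp only [Bool.and_eq_true, decide_eq_true_eq] at h1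
  obtain ⟨⟨he0, h2⟩, h3⟩ := h1
  obtain ⟨hv1, hv2⟩ := lin7TupleVal_mem_encl e he0
  exact ⟨(Rat.cast_le.mpr h2).trans hv1, hv2.trans (Rat.cast_le.mpr h3)⟩

/-- The thirteen enclosures lie inside the σ-cell's end points (milliseconds). [folklore] -/
theorem linTuplesInside_σcell : linTuplesInside (33957 / 65536) (16979 / 32768) σcellLinEx = true := by
  decide +kernel

/-- **Each listed `LIN` value lies in the σ-cell.** [folklore] -/
theorem σcellLinEx_mem_σcell {e : ℤ × List ℤ × ℕ} (he : e ∈ σcellLinEx) : lin7TupleVal e ∈ σcell := by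
  obtain ⟨h1, h2⟩ := linTuplesInside_sound linTuplesInside_σcell he
  simp only [σcell, mem_Icc]
  push_cast at h1 h2
  exact ⟨h1, h2⟩

/-- Decidable side conditions of `linFamily H` for a tuple: seven coefficients in `[−H, H]`, at most two
non-zero, not all zero, `1 ≤ aₓ ≤ H`. [folklore] -/
def linTupleOK (H : ℕ) (e : ℤ × List ℤ × ℕ) : Bool :=
  decide (e.2.1.length = 7) && decide (1 ≤ e.2.2) && decide (e.2.2 ≤ H) &&
    (e.2.1.all fun y => decide (-(H : ℤ) ≤ y) && decide (y ≤ H)) &&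
    decide ((e.2.1.filter (· ≠ 0)).length ≤ 2) && decide (e.2.1 ≠ [0, 0, 0, 0, 0, 0, 0])

/-- Soundness of `linTupleOK`: the tuple's value is a member of `linFamily H`. [folklore] -/
theorem mem_linFamily_of_linTupleOK {H : ℕ} {e : ℤ × List ℤ × ℕ} (h : linTupleOK H e = true) :
    lin7TupleVal e ∈ linFamily H := by
  simp only [linTupleOK, Bool.and_eq_true, decide_eq_true_eq, List.all_eq_true] at h
  obtain ⟨⟨⟨⟨⟨hlen, h1⟩, h2⟩, hb⟩, hf⟩, hne⟩ := h
  exact ⟨e.1, e.2.1, e.2.2, hlen, h1, h2, fun y hy => hb y hy, hf, hne, rfl⟩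

/-- The thirteen listed tuples satisfy the side conditions of `linFamily 12`. [folklore] -/
theorem linTupleOK_σcellLinEx : σcellLinEx.all (linTupleOK 12) = true := by
  decide +kernel

/-- **Each listed `LIN` tuple is a member of the frozen table** (`H = 12`), so with completeness the list
is exact. [folklore] -/
theorem σcellLinEx_mem_linFamily {e : ℤ × List ℤ × ℕ} (he : e ∈ σcellLinEx) :
    lin7TupleVal e ∈ linFamily 12 :=
  mem_linFamily_of_linTupleOK (List.all_eq_true.mp linTupleOK_σcellLinEx e he)

/-- Separation test for two tuples: both have `aₓ > 0` and their certified enclosures are DISJOINT.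
[folklore] -/
def linSep (e f : ℤ × List ℤ × ℕ) : Bool :=
  decide (0 < e.2.2) && decide (0 < f.2.2) &&
    (decide ((linTupleEncl e).2 < (linTupleEncl f).1) || decide ((linTupleEncl f).2 < (linTupleEncl e).1))

/-- Separated tuples have different values. [folklore] -/
theorem lin7TupleVal_ne_of_linSep {e f : ℤ × List ℤ × ℕ} (h : linSep e f = true) :
    lin7TupleVal e ≠ lin7TupleVal f := by
  simp only [linSep, Bool.and_eq_true, Bool.or_eq_true, decide_eq_true_eq] at h
  obtain ⟨⟨he, hf⟩, hd⟩ := h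
  obtain ⟨he1, he2⟩ := lin7TupleVal_mem_encl e he
  obtain ⟨hf1, hf2⟩ := lin7TupleVal_mem_encl f hf
  rcases hd with hd | hd
  · have hd' : (((linTupleEncl e).2 : ℚ) : ℝ) < (((linTupleEncl f).1 : ℚ) : ℝ) := Rat.cast_lt.mpr hd
    exact ne_of_lt (lt_of_le_of_lt he2 (lt_of_lt_of_le hd' hf1))
  · have hd' : (((linTupleEncl f).2 : ℚ) : ℝ) < (((linTupleEncl e).1 : ℚ) : ℝ) := Rat.cast_lt.mpr hd
    exact ne_of_gt (lt_of_le_of_lt hf2 (lt_of_lt_of_le hd' he1))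

/-- The thirteen enclosures are pairwise disjoint (milliseconds). [folklore] -/
theorem σcellLinEx_separated : σcellLinEx.Pairwise fun e f => linSep e f = true := by
  decide +kernel

/-- **The thirteen listed `LIN` values are pairwise distinct.** [folklore] -/
theorem σcellLinEx_nodup_values : (σcellLinEx.map lin7TupleVal).Nodup := by
  rw [List.Nodup, List.pairwise_map]
  exact σcellLinEx_separated.imp fun h => lin7TupleVal_ne_of_linSep h

/-- The list has thirteen entries. [folklore] -/
theorem σcellLinEx_length : σcellLinEx.length = 13 := rfl

/-! ### Counting: thirteen distinct `LIN` values -/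

/-- If the members of a set of reals are exactly the entries of a duplicate-free list, the set has
`L.length` elements. [folklore] -/
theorem real_ncard_eq_length_of_iff {S : Set ℝ} {L : List ℝ} (hL : L.Nodup) (h : ∀ r, r ∈ S ↔ r ∈ L) :
    S.ncard = L.length := by
  classical
  have hS : S = ↑L.toFinset := Set.ext fun r => by rw [Finset.mem_coe, List.mem_toFinset]; exact h r
  rw [hS, Set.ncard_coe_finset, List.toFinset_card_of_nodup hL]

/-- **The `LIN` members of the σ-cell are exactly 13 distinct real numbers.** [folklore] -/
theorem σcell_lin_ncard : {x : ℝ | x ∈ σcell ∧ x ∈ linFamily 12}.ncard = 13 := by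
  have hiff : ∀ r, r ∈ {x : ℝ | x ∈ σcell ∧ x ∈ linFamily 12} ↔ r ∈ σcellLinEx.map lin7TupleVal := fun r => by
    rw [List.mem_map]
    constructor
    · rintro ⟨hr, hm⟩
      obtain ⟨e, he, rfl⟩ := lin_listed_of_mem_σcell hr hm
      exact ⟨e, he, rfl⟩
    · rintro ⟨e, he, rfl⟩
      exact ⟨σcellLinEx_mem_σcell he, σcellLinEx_mem_linFamily he⟩
  rw [real_ncard_eq_length_of_iff σcellLinEx_nodup_values hiff]
  simp [σcellLinEx]

/-! ### The `Γ`-free `TRG` sub-table on the σ-cell: one member, `(2/5)·√2·G` -/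

/-- The `Γ`-free `TRG` tuples `(p, q, u, a, L, s)` (value `(p/q)·u·π^{a/2}·L^s`) in the σ-cell: the single
tuple `(2, 5, 1, 0, 4, 1)` = `(2/5)·√2·G` (complexity `(D, h) = (3, 5)`; §7.3's «simplest»). [folklore] -/
def σcellTrgEx : List (ℕ × ℕ × ℕ × ℤ × ℕ × ℤ) := [(2, 5, 1, 0, 4, 1)]

/-- The `Γ`-free `TRG` sentence (`D ≤ 12`, `h ≤ 32`, `L ∈ {log 2, e, ζ(3), ζ(5), G}`) on `σW`
(one `decide +kernel`). [folklore] -/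
theorem trgExcluded_σW : trgExcluded 12 32 σWlo σWhi σcellTrgEx = true := by
  decide +kernel

/-- **Completeness on the σ-cell, `Γ`-free `TRG`.** A member of `trgFamily 12 32` in the σ-cell is the value
of the single listed tuple. [folklore] -/
theorem trg_listed_of_mem_σcell {x : ℝ} (hx : x ∈ σcell) (hm : x ∈ trgFamily 12 32) :
    ∃ e ∈ σcellTrgEx, x = trgLTupleVal e :=
  trgExcluded_sound trgExcluded_σW (mem_σW_of_mem_σcell hx) hm

/-- The single tuple's value is `(2/5)·√2·G` (the number p640404's `trg_example_mem_σcell` places in the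
cell). [folklore] -/
theorem trgLTupleVal_σcellTrgEx : trgLTupleVal (2, 5, 1, 0, 4, 1) = (2 / 5 : ℝ) * Real.sqrt 2 * catalan := by
  simp only [trgLTupleVal, trgLVal, uVal, l5Val, zpow_zero, zpow_one, mul_one]
  push_cast
  ring

/-- Hence: **a `Γ`-free `TRG` member in the σ-cell IS `(2/5)·√2·G`.** [folklore] -/
theorem trg_eq_of_mem_σcell {x : ℝ} (hx : x ∈ σcell) (hm : x ∈ trgFamily 12 32) :
    x = (2 / 5 : ℝ) * Real.sqrt 2 * catalan := by
  obtain ⟨e, he, hxe⟩ := trg_listed_of_mem_σcell hx hm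
  simp only [σcellTrgEx, List.mem_singleton] at he
  rw [hxe, he, trgLTupleVal_σcellTrgEx]

end ColumnFaceL11
end Summit.CriticalPhenomena.Ising3D
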